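import Summits.AtomisticToContinuum.Crystallization.Theorems.ChargedEnergyGapChamberCert
import HarnessLib

/-!
# ChargedEnergyGap · NODE 113C «CentreBox» — the centre range of a chamber station is IMPLIED by the full-normal-form hypotheses

decomp-a2c lens-3 g93 (memo MUDIET-SPEC-g93 §3 «CENTRE-BOX-93b»; imports TREE 112 «ChamberCert» only).

WHY.  A station certificate (110E `StationCert.sound`, 112 `sound_chamber`, 113B `sound_diet`) takes the centre range `loC ≤ dt 0 ≤ hiC` as a HYPOTHESIS;
the cover (D4) must discharge it from what `stencilChartLawQ_of_fullNormalForm` supplies.  Two tree facts do it, with no linearisation: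
* LOWER: `IsTupleHole` says the max-kink is `≥ 1` (kink column `≥ 2`), and in the axis-zero chamber the max-kink IS the axis-`0` kink
  `(2·dt 0 − poleSum dt 0)/ρ` (`hMaxKink_of_axisZero`, `hKink_zero_eq_poleSum`): hence `poleSum dt 0 / 2 + ρ/2 ≤ dt 0`, so for `ρ0 ≤ ρ` and pole depths
  `lo_0T ≤ dt(e_0)`, `lo_0F ≤ dt(−e_0)`: `(lo_0T + lo_0F + ρ0)/2 ≤ dt 0` (`centre_lower_of_hole`, `centre_lower_of_box`).
* UPPER: chart realisability gives `|dt 0| ≤ dt q + ρ` for every hole vertex `q` (`abs_le_of_chart` with `G(q, centre) = 1`): hence `dt 0 ≤ hi_q + ρ1`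
  (`centre_upper_of_chart`, `centre_upper_of_box`).
So the v5b centre box `[(lo_0T + lo_0F + ρ0)/2, min_q hi_q + ρ1]` of the emitter is exactly dischargeable; the v4 box `[max hi − 7/10, min lo + 7/10]` was not.
-/

open scoped Classical
open Literature.MathematicalPhysics.StatisticalMechanics Literature.Geometry.DiscreteGeometry
open Summit.AtomisticToContinuum.Crystallization.Theses.PricedLinkCensus
open Summit.AtomisticToContinuum.Crystallization.Theorems.ChargedEnergyGapNegative

namespace Summit.AtomisticToContinuum.Crystallization.Theorems.ChargedEnergyGapChartDial

/-- ★ LOWER CENTRE BOUND from the hole condition in the axis-zero chamber: `poleSum dt 0 / 2 + ρ / 2 ≤ dt 0`. -/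
theorem centre_lower_of_hole {dK ρ : ℝ} (hρ : 0 < ρ) {dt : (Fin 3 → ℤ) → ℝ} (hH : IsTupleHole dK ρ dt)
    (h1 : poleSum dt 0 ≤ poleSum dt 1) (h2 : poleSum dt 0 ≤ poleSum dt 2) : poleSum dt 0 / 2 + ρ / 2 ≤ dt 0 := by
  obtain ⟨-, hcol, -, -⟩ := hH
  have hJ : 1 ≤ hMaxKink ρ dt 0 := by
    by_contra hlt
    rw [not_le] at hlt
    unfold capKCol at hcol
    split_ifs at hcol <;> norm_num at hcol
  rw [hMaxKink_of_axisZero hρ h1 h2, hKink_zero_eq_poleSum, le_div_iff₀ hρ] at hJ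
  linarith

/-- ★ LOWER CENTRE BOUND, box form: `(lo_0T + lo_0F + ρ0)/2 ≤ dt 0` whenever `ρ0 ≤ ρ` and the axis-`0` poles are at depths `≥ lo_0T`, `≥ lo_0F`. -/
theorem centre_lower_of_box {dK ρ ρ0 loT loF : ℝ} (hρ : 0 < ρ) (h0 : ρ0 ≤ ρ) {dt : (Fin 3 → ℤ) → ℝ} (hH : IsTupleHole dK ρ dt)
    (h1 : poleSum dt 0 ≤ poleSum dt 1) (h2 : poleSum dt 0 ≤ poleSum dt 2) (hT : loT ≤ dt (holeVertex 0 (0, true)))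
    (hF : loF ≤ dt (holeVertex 0 (0, false))) : (loT + loF + ρ0) / 2 ≤ dt 0 := by
  have h := centre_lower_of_hole hρ hH h1 h2
  unfold poleSum at h
  linarith

/-- ★ UPPER CENTRE BOUND from chart realisability: `dt 0 ≤ dt q + ρ` for every hole vertex `q` of non-negative depth (`G(q, centre) = 1`). -/
theorem centre_upper_of_chart {ρ : ℝ} (hρ : 0 ≤ ρ) {dt : (Fin 3 → ℤ) → ℝ} (hreal : IsChartRealisable ρ dt) (q : Fin 3 × Bool)
    (hq : 0 ≤ dt (holeVertex 0 q)) : dt 0 ≤ dt (holeVertex 0 q) + ρ := by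
  have hG : stG (some q) none ≤ (1 : ℝ) ^ 2 := by
    rw [← cast_stGQ, one_pow, show (1 : ℝ) = ((1 : ℚ) : ℝ) by norm_num, Rat.cast_le]
    obtain ⟨a, s⟩ := q
    fin_cases a <;> cases s <;> decide
  have h := abs_le_of_chart hreal hρ (some q) none (by simpa using hq) zero_le_one hG
  simp only [stPt_none, stPt_some, mul_one] at h
  exact (le_abs_self _).trans h

/-- ★ UPPER CENTRE BOUND, box form: `dt 0 ≤ hi_q + ρ1` whenever `ρ ≤ ρ1` and the hole vertex `q` has depth in `[0, hi_q]`. -/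
theorem centre_upper_of_box {ρ ρ1 hiq : ℝ} (hρ : 0 ≤ ρ) (h1 : ρ ≤ ρ1) {dt : (Fin 3 → ℤ) → ℝ} (hreal : IsChartRealisable ρ dt) (q : Fin 3 × Bool)
    (hq : 0 ≤ dt (holeVertex 0 q)) (hhi : dt (holeVertex 0 q) ≤ hiq) : dt 0 ≤ hiq + ρ1 := by
  have h := centre_upper_of_chart hρ hreal q hq
  linarith

end Summit.AtomisticToContinuum.Crystallization.Theorems.ChargedEnergyGapChartDial
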